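import Mathlib
import HarnessLib
import HarnessLib.Audit
import Summits.RiemannHypothesis.Statement
import Summits.RiemannHypothesis.RiemannHypothesis.Theorems.LiCoefficientsDefs
import Literature.NumberTheory.LFunctions.KeiperLiPositivityUpTo
import Literature.NumberTheory.LFunctions.SchoenfeldZeroSums
import Literature.NumberTheory.LFunctions.RiemannSiegelFacts
import Literature.NumberTheory.LFunctions.TuringMethodTuringBound
import Literature.NumberTheory.LFunctions.ZetaArgBacklundExplicit
import Literature.NumberTheory.LFunctions.RiemannSiegelThetaBounds
import Literature.NumberTheory.DiophantineGeometry.NamedHypotheses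
import Summits.RiemannHypothesis.RiemannHypothesis.Theorems.LiCoefficientsLiHeightLaw
import HarnessLib.Audit.Status.Attr

/-!
Route: LiCoefficients

CLOSED (proved) 2026-08-26T11:49:22Z by operator:999:2699978 — reason: proved:Summit.RiemannHypothesis.RiemannHypothesis.Theorems.LiTheory.liHeightLawQuadratic_holds — note: PROVED close: rung L-P(P1) Li height law; items 19468–19471 closed·proved; leaf p409221 (director-rh g5 11:17:38Z). The file is kept as the record of this route; refuted decls are indexed as negative knowledge (`ledger negatives`).

# Route LiCoefficients — Li's criterion door; RH-free height law λ_n ≥ 0 for n ≤ T²/5 from RH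
verified to T

Column LI of the RH ladder (D-0040/D-0059/D-0061). The DOOR is Li's criterion `RH ↔ ∀ n ≥ 1, λ_n ≥
0`
(`Literature.NumberTheory.LFunctions.li_criterion_holds`, kernel; RH-EQUIVALENT·KNOWN, not an item).
The route
closes the RUNG LEAF L-P(P1), the RH-FREE Li HEIGHT LAW in the quadratic range: if every zero of ζ
with
`0 < Im ρ ≤ T` (`T ≥ 10⁵`) is on the critical line then `λ_n = keiperLiCoeff n ≥ 0` for every `1 ≤ n
≤ T²/5`
(the kernel has the LINEAR range `n ≤ 2π(T − 4)`, `keiperLiCoeff_nonneg_of_riemannHypothesisUpTo`).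
It suffices
to show X = LiBoxSplit ∧ LiWindowLowerBound ∧ LiFarZeroTail ∧ LiHeightBudget: the Bombieri–Lagarias
box sum splits
into the verified window (on-line phases, counted by Backlund–Turing) and the far pairs (`≥ −2.82
n²/|ρ|⁴`, summed
by RH-free zero counting), and an explicit budget closes for `n ≤ T²/5`.
Lean: `Summit.RiemannHypothesis.RiemannHypothesis.Theorems.LiTheory.LiHeightLawQuadratic`

## Assembly
`closes (h5 : LiBoxSplit) (h4 : LiWindowLowerBound) (h3 : LiFarZeroTail) (h6 : LiHeightBudget) (hA :
Assembly) : Theorems.LiTheory.LiHeightLawQuadratic := hA h5 h4 h3 h6` (glue.lean). The Assembly item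
is PROVABLE NOW — its 30-line proof (real-inequality logic) is HOME/theory/route/AssemblyProof.lean
(farm rc 0): for `n ≤ 2π(T−4)` the tree's linear law
`keiperLiCoeff_nonneg_of_riemannHypothesisUpTo`; otherwise `T₂ = min(T, n/13) ≥ 1100`, `B = log
T/(6πT³)` from L3, split by L5, window bounded by L4, and the budget L6 makes the right-hand side ≥
0. Under D-0061 (R5) the conclusion is the registered rung leaf `LiHeightLawQuadratic` («closes rung
L-P(P1) of RiemannHypothesis», never summit credit); the door to the summit is `li_criterion_holds`
and is NOT claimed.

CLOSES_TARGET: closes rung L-P(P1) of RiemannHypothesis: Summit.RiemannHypothesis.RiemannHypothesis.Theorems.LiTheory.LiHeightLawQuadratic (D-0061; not the summit Statement) — the deciding theorem of this route concludes that registered leaf instead of the Statement decl `RiemannHypothesis` (class rung: servable and labelled, never counted as concluding the summit Statement).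

Rationale: WHY THIS LINE. Li's sum `λ_n = Σ*_ρ m(ρ)[1 − (1 − 1/ρ)ⁿ]` (tree: `keiperLiCoeff_eq_zero_sum_holds`,
Li1997 (1.4), BombieriLagarias1999
Thm 1) is termwise `1 − cos(nθ_γ) ≥ 0` on the line (`θ_γ = 2 arctan(1/2γ) ≈ 1/γ`) and, for a
hypothetical off-line
pair above the verified height `T`, at least `−2.82 n²/|ρ|⁴`; so positivity for `n ≫ T` needs a
LOWER bound for the
on-line window sum `Σ_{T₂/2<γ≤T₂}(1 − cos nθ_γ)` against the far tail `2.82 n² Σ_{γ>T} m/γ⁴ ≤ 2.82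
n² log T/(6πT³)`.
The window sum is evaluated by the explicit Riemann–von Mangoldt formula with Backlund's explicit
`S(t)` bound
(`abs_zetaArgS_le_explicit`, Trudgian 2014) and TURING's mean-value bound `|∫S| ≤ 2.30 + 0.128
log(T/2π)`
(`abs_integral_zetaArgS_le_turing_holds`) after integrating by parts against the weight — the
imported input from
computational zero-verification practice (Turing's method) that makes the window `T₂ = min(T, n/13)`
affordable.
Brown 2005 Thm 2 printed `n ≤ 2T² log T` with an incomplete proof (Droll 2012 Conj. 1.7.10;
Palojärvi 2020 §1;
tree docstring of `KeiperLiPositivityUpTo`); Oesterlé's `n ≤ T²` (2000) is unpublished: a complete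
proof of a
quadratic range is new in print. Nothing in the negatives index concerns Li coefficients.

RANKED CRUXES. #2 LiBoxSplit (crux) — (L5) For RH verified to `T`, `1100 ≤ T₂ ≤ T`, `1 ≤ n ≤ T²/4`
and any bound `B` on the far tails `Σ_{T<γ≤U} m/γ⁴` (all `U ≥ T`): `λ_n ≥ 2·Σ_{T₂/2<γ≤T₂} m f_n(γ) −
2.82 n² B` — the Bombieri–Lagarias box sum split into verified window (on-line terms `f_n = 1 − cos
nθ ≥ 0`, L1) and reflected far pairs (L2), in the symmetric limit. [difficulty: L] (why it might
fail: the far-pair bound needs `n ≤ |ρ|²/4` for EVERY zero above T (true as `n ≤ T²/4 < γ²/4`); the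
symmetric-limit bookkeeping (conjugates double, reflection pairs) must match `liZeroBox` exactly — a
factor-2 slip breaks the constant 2.82.) [Li1997, BombieriLagarias1999, BrownLiCriterion2005,
doi:10.1016/j.jnt.2004.07.016]
#3 LiWindowLowerBound (crux) — (L4) RH-free: for `T₂ ≥ 1100` and `n ≥ 1`, the zeros with `T₂/2 < Im
ρ ≤ T₂` (any real parts) satisfy `Σ m(ρ) f_n(Im ρ) ≥ liWindowBound n T₂ = (T₂/4π)(log(T₂/2π) − 0.31)
− 0.36(T₂²/n)log(T₂/2π) − 1.24 log T₂ − 14 − (2.30 + 0.128 log(T₂/2π))(4n/T₂² + (7/3)n²/T₂³)` —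
Riemann–von Mangoldt main term, stationary-phase-free oscillatory bound, Backlund boundary terms,
Turing's ∫S bound by parts. [difficulty: L] (why it might fail: the by-parts step uses Turing's
bound on SUB-intervals of (T₂/2, T₂] where f_n' changes size; if only the full-interval form
`abs_integral_zetaArgS_le_turing_holds` applies, the coefficient (7/3)n²/T₂³ may need (10/3), eating
the budget's slack at n = T²/5.) [Trudgian2014, doi:10.1016/j.jnt.2013.07.017, Turing1953,
RosserSchoenfeld1975]
#4 LiHeightBudget (crux) — (L6) The closed real inequality: for `T ≥ 10⁵`, `2π(T − 4) < n ≤ T²/5`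
and `T₂ = min(T, n/13)`: `0 ≤ 2·liWindowBound n T₂ − 2.82 n² log T/(6πT³)` (two regimes: `n ≥ 13T`
concave in ε = n/T², endpoints 0.76T / 0.95T; `n < 13T` minimum 0.42T at the seam; float grid
budget_cases.py). [deps: LiWindowLowerBound, LiFarZeroTail] [difficulty: M] (why it might fail: only
a float grid was run (min 0.42·T at n = 2π(T−4), T = 10⁵); an interval-arithmetic pass could find a
dip between grid points near the seam n ≈ 13T where the regime switches — then c = 1/5 drops to the
crude 1/10.) [BrownLiCriterion2005, folder:budget_cases.py]
#9 LiFarZeroTail (support) — (L3; PROVED IN TREE 2026-08-25T20:40Z as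
`Summit.RiemannHypothesis.RiemannHypothesis.Theorems.LiTheory.liFarZeroTail_bound`,
Theorems/LiCoefficientsLiFarZeroTail.lean, p407363 commit e3ee6eed1ac0 — verbatim this signature;
kept as an in-cone SUPPORT item cited by name so `closes`/Assembly keep their shape, closes at birth
by type match) RH-free zero counting: for `1000 ≤ T ≤ U`, `Σ_{T<Im ρ≤U} m(ρ)/(Im ρ)⁴ ≤ log T/(6πT³)`
(partial summation of t⁻⁴ against the explicit two-height count `N(t) − N(T)`; main term `(log(T/2π)
+ 1/3)/(6πT³)`, slack `(log 2π − 1/3)/(6πT³)` covers the S-terms `(1.24 log T + 6.8)/T⁴`).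
[difficulty: provable-now] (why it might fail: it cannot any more — proved in the tree (before: the
constant is tight to 5%·log at T = 1000).) [Trudgian2014, RosserSchoenfeld1975,
doi:10.1090/S0025-5718-1975-0369287-6, tree:Theorems/LiCoefficientsLiFarZeroTail.lean]

TWO-LAYER PLAN. Foreseen glued splits (skeletons checked in HOME/theory/route/Birth.lean, rc 0,
sorries = stubs; registered as `Cruxes/<Crux>/Lines/birth.lean` after birth): LiBoxSplit ⇐
LiOnLineTerm (L1) → LiFarPairLowerBound (L2, closed strip) → BoxDecomp (RH-free
conjugation/reflection bookkeeping of the `liZeroBox` sum) — composition PROVED with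
`keiperLiCoeff_eq_zero_sum_holds`; LiWindowLowerBound ⇐ LiWindowIdentity (S1) → LiThetaMain (S2) →
LiThetaOsc (S3) → LiBacklundBoundary (S4) → LiTuringByParts (S5) — composition PROVED (a 5-stub
line, not a route-level split); LiFarZeroTail ⇐ CountDiff → TailFromCount; LiHeightBudget ⇐ CaseA (n
≥ 13T) → CaseB (n < 13T) — composition PROVED.

KILL CRITERIA. LiFarZeroTail is PROVED (tree `liFarZeroTail_bound`); a refutation of LiHeightBudget
AS TYPED (constants) forces a restatement with a larger threshold / smaller c (the leaf survives
with c = 1/10, T₀ = 10⁶ = `LiHeightLawQuadraticCrude`); a refutation of LiBoxSplit's constant 2.82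
(pair bound) pivots to the sharp pair constant 0.26·(…) with the hypothesis |Re ρ − ½| ≤ ½ explicit;
a refutation of LiWindowLowerBound with coefficient 7/3 → 10/3 forces c = 1/6. The route is closed
`refuted` only if a NEGATIVE λ_n with n ≤ T²/5 is certified for some verified T ≥ 10⁵ (that would
also refute RH). Proved elsewhere that moots it: a landed proof of Brown's Lemma 5 (n ≤ 2T² log T).

NOT DECOMPOSED YET. The support lemmas L1/L2/S1–S5/CountDiff/CaseA/CaseB are stubs of the registered
birth lines, not items (BC6: the cone of `closes` is the three cruxes + the proved support
LiFarZeroTail + Assembly); interval-arithmetic certification of L6 and of the numerical constants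
0.31/0.36/0.4413/1.24/12.96 in S2–S4 is left to the provers (layer 2). The NB half of the column
(leaf L-P(P2) `NbTailConstIdentity`, targets T1–T7) is NOT in this route: by D-0059(a) it attaches
to route-RiemannHypothesis-NymanBeurling as items.

CHEAPEST FALSIFIER. Compute λ_n by the tree-independent Keiper/Arb tables (Johansson 2015 reaches n
= 10⁵; Maślanka n ≤ 4000) — all positive, consistent; the real falsifier of the LINE is the budget
at the seam: evaluate `2·liWindowBound n (n/13) − 2.82 n² log T/(6πT³)` at T = 10⁵, n = ⌈2π(T−4)⌉ =
628 294: float value 4.24·10⁴ > 0 (budget_cases.py, ran: min over the grid 0.424·T). A refuter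
re-runs it in interval arithmetic (kit, seconds).

NUMBERS. Linear range in tree: n ≤ 2π(T − 4) (`keiperLiCoeff_nonneg_of_riemannHypothesisUpTo`); at
the Platt–Trudgian height T = 3 000 175 332 800 (PlattTrudgianBLMS2021 Thm 1): tree 1.885·10¹³, this
route 1.8·10²⁴ (`LiPositivityPlattTrudgian24`, proved from the leaf). Explicit S(t): |S(t)| ≤ 0.3083
log t + 3.24 wait-free form in tree `ZetaArgBacklund.abs_zetaArgS_le_explicit` (t ≥ 30; Trudgian2014
has 0.112 log t + 0.278 log log t + 2.510). Turing: |∫_{t₁}^{t₂} S| ≤ 2.30 + 0.128 log(t₂/2π)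
(`abs_integral_zetaArgS_le_turing_holds`, t₁ ≥ 168π). Far pair: 2(cosh x − 1) ≤ 1.0146 x² for |x| ≤
5/12, |x| ≤ (5/3)n/|ρ|² ⇒ constant 2.82. Budget minimum 0.424·T (float) at the seam.

DEFINITION REQUESTS. None: the vocabulary (`liZeroAngle`, `liWindowWeight`, `liWindowWeightDeriv`,
`liWindowBound`) and the leaf constants (`LiHeightLawQuadratic`, `LiHeightLawQuadraticCrude`,
`LiPositivityPlattTrudgian24`, NB `NbTailConstIdentity` + NB vocabulary) are in
`Theorems/LiCoefficientsDefs.lean` (HOME/theory/route/LiCoefficientsDefs.lean, farm rc 0 / 0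
sorries; landing requested from rh-li-prover, `ledger propose --kind definition`).

Novelty: Searches (2026-08-25): lit search --hybrid "nonnegativity of Li coefficients from partial
verification of RH up to height T, n ≤ T²" (8 hits: Brown 2005, Droll 2012, Palojärvi 2020, Oesterlé
mention only); lit vsearch same prose (8); lit galaxy search "Li's criterion|Li
coefficients|Keiper-Li" --star all (hits: surveys/theses, no quadratic-range proof); corpus reads
[corpus:paper:doi-10-1016-j-jnt-2004-07-016 p.5 Thm 2, pp.18–19 Lemma 5], [corpus:paper:w2187263254
Droll thesis pp.49–50 Conj. 1.7.10, p.101, p.113], [corpus:paper:arxiv-1807.01506 p.3] (Palojärvi: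
Brown's proof incomplete); lean search keiperLiCoeff (tree: linear range only); 21:10Z re-search lit
search "Arias de Reyna Keiper Li coefficients asymptotic" --source local (3 hits: arXiv:1703.02844
Voros 2018, arXiv:2204.01036 Voros 2022, arXiv:1309.2877 Johansson).
Nearest prior art found: BrownLiCriterion2005 (doi:10.1016/j.jnt.2004.07.016) Thm 2 — asserts n ≤
2T² log T under a lens hypothesis, proof of Lemma 5 incomplete (Droll 2012 Conj. 1.7.10;
arXiv:1807.01506 §1); Oesterlé 2000 (unpublished, reported in Biane–Pitman–Yor Bull. AMS 38 p.441):
n ≤ T²; Voros 2018 (Exp. Math., arXiv:1703.02844) [corpus:paper:arxiv-1703.02844 p.3]: «Li's sign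
test is, by (OP) [Oesterlé, private], inactive up to n = T₀²» and the uncertainty-principle CEILING
«sensitivity to RH only for n ≳ 2T₀²» — i.e. the quadratic range is folklore WITHOUT a published
proof, and no λ_n-sign statement can be RH-free beyond n ≍ T².
Delta: a complete,  [refs: 10.1016/j.jnt.2004.07.016, 1703.02844, 2204.01036, 1309.2877, 1807.01506, paper:doi-10-1016-j-jnt-2004-07-016, paper:w2187263254, paper:arxiv-1807.01506, doi:10.1016/j.jnt.2004.07.016, paper:arxiv-1703.02844, BrownLiCriterion2005]

Barriers (technique_class: explicit-zero-counting, backlund-turing, li-keiper-zero-sum): - technique_class: explicit-zero-counting, backlund-turing, li-keiper-zero-sum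
- Literature.Barriers.RiemannHypothesis.BoundedFluctuationCounting: outside — the line never assumes
S(t) bounded; it uses the proved |S(t)| ≤ 0.3083 log t + 3.24 and Turing's proved mean bound, both
consistent with Selberg's Ω-results.
- Literature.Barriers.RiemannHypothesis.GramRosserFailures: outside — Turing's bound
`abs_integral_zetaArgS_le_turing_holds` is a theorem that does not assume Gram's law or Rosser's
rule; no sign-pattern certificate is used.
- Literature.Barriers.RiemannHypothesis.LindelofBacklund: outside — no size estimate for ζ is
upgraded to a zero-free statement; the conclusion is finitely many signs λ_n ≥ 0 from a finite
verified height, not RH (the door li_criterion needs ALL n and is not claimed).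
- Literature.Barriers.RiemannHypothesis.NymanBeurlingObstructions / MollifierLimitations: not in
this route's class (they concern the NB column's P3 door, route NymanBeurling).
- Negatives index: `ledger negatives --problem RiemannHypothesis` re-read 2026-08-25T21:35Z lists 2
refuted statements (stmt-RiemannHypothesis-16980 Jacobi-symbol sine-sum positivity, route
CharacterSums; stmt-RiemannHypothesis-2575 de Bruijn universal-factor real-zeros, route
UniversalFactor) — none about Li/Keiper coefficients, zero counting or S(t); nothing to steer
around.

History (route lifecycle, newest last):
- 2026-08-26T11:49:22Z · CLOSED proved — proved:Summit.RiemannHypothesis.RiemannHypothesis.Theorems.LiTheory.liHeightLawQuadratic_holds (operator:999:2699978)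

sub-problem: RiemannHypothesis · status: closed(proved) · opened planner-rh-li-theory-g4-0 2026-08-25T21:47:56Z · rev 1 · ledger route-RiemannHypothesis-LiCoefficients
GENERATED by the gate from the ledger (D-0016/17). Provers cite these decls: `theorem foo : Summit.RiemannHypothesis.RiemannHypothesis.Theses.LiCoefficients.<Decl> := …` in Summits/RiemannHypothesis/RiemannHypothesis/Theorems/<Name>.lean.
-/

namespace Summit.RiemannHypothesis.RiemannHypothesis.Theses.LiCoefficients

open scoped BigOperators Topology Manifold Classical MeasureTheory ProbabilityTheory Matrix InnerProductSpace ComplexConjugate ContinuousMap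
open Filter Set Function TopologicalSpace MeasureTheory

attribute [summit_statement] _root_.Summit.RiemannHypothesis
attribute [summit_statement] _root_.Summit.RiemannHypothesis.RiemannHypothesis.Theorems.LiTheory.LiHeightLawQuadratic

open Summit

/-- item stmt-RiemannHypothesis-19467 · crux · rank 2 · closed · proved by Summit.RiemannHypothesis.RiemannHypothesis.Theorems.LiTheory.liBoxSplit_bound @ ce3e7fc06eb8 (prover) · by planner
why it might fail: the far-pair bound needs `n ≤ |ρ|²/4` for EVERY zero above T (true as `n ≤ T²/4 < γ²/4`); the symmetric-limit bookkeeping (conjugates double, reflection pairs) must match `liZeroBox` exactly — a factor-2 slip breaks the constant 2.82.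
sources: Li1997, BombieriLagarias1999, BrownLiCriterion2005, doi:10.1016/j.jnt.2004.07.016
[crux] (L5) For RH verified to `T`, `1100 ≤ T₂ ≤ T`, `1 ≤ n ≤ T²/4` and any bound `B` on the far
tails `Σ_{T<γ≤U} m/γ⁴` (all `U ≥ T`): `λ_n ≥ 2·Σ_{T₂/2<γ≤T₂} m f_n(γ) − 2.82 n² B` — the
Bombieri–Lagarias box sum split into verified window (on-line terms `f_n = 1 − cos nθ ≥ 0`, L1) and
reflected far pairs (L2), in the symmetric limit. [difficulty: L] -/
@[route_item "route-RiemannHypothesis-LiCoefficients", crux]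
def LiBoxSplit : Prop :=
  ∀ (n : ℕ) (T T₂ B : ℝ), Literature.NumberTheory.DiophantineGeometry.RiemannHypothesisUpTo T → 1100 ≤ T₂ → T₂ ≤ T → 1 ≤ n → (n : ℝ) ≤ T ^ 2 / 4 → (∀ U : ℝ, T ≤ U → ∑ ρ ∈ Literature.NumberTheory.LFunctions.SchoenfeldBound.zerosBetween T U, (Literature.NumberTheory.LFunctions.riemannZetaZeroOrder ρ : ℝ) / ρ.im ^ 4 ≤ B) → 2 * (∑ ρ ∈ Literature.NumberTheory.LFunctions.SchoenfeldBound.zerosBetween (T₂ / 2) T₂, (Literature.NumberTheory.LFunctions.riemannZetaZeroOrder ρ : ℝ) * Summit.RiemannHypothesis.RiemannHypothesis.Theorems.LiTheory.liWindowWeight n ρ.im) - 2.82 * (n : ℝ) ^ 2 * B ≤ Literature.NumberTheory.LFunctions.keiperLiCoeff n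

/-- `LiBoxSplit` holds: proved by `Summit.RiemannHypothesis.RiemannHypothesis.Theorems.LiTheory.liBoxSplit_bound` @ ce3e7fc06eb8. -/
theorem LiBoxSplit_holds : LiBoxSplit := _root_.Summit.RiemannHypothesis.RiemannHypothesis.Theorems.LiTheory.liBoxSplit_bound

/-- item stmt-RiemannHypothesis-19468 · crux · rank 3 · closed · proved by Summit.RiemannHypothesis.RiemannHypothesis.Theorems.LiTheory.liWindowLowerBound_bound @ ce3e7fc06eb8 (prover) · by planner
why it might fail: the by-parts step uses Turing's bound on SUB-intervals of (T₂/2, T₂] where f_n' changes size; if only the full-interval form `abs_integral_zetaArgS_le_turing_holds` applies, the coefficient (7/3)n²/T₂³ may need (10/3), eating the budget's slack at n = T²/5.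
sources: Trudgian2014, doi:10.1016/j.jnt.2013.07.017, Turing1953, RosserSchoenfeld1975
[crux] (L4) RH-free: for `T₂ ≥ 1100` and `n ≥ 1`, the zeros with `T₂/2 < Im ρ ≤ T₂` (any real parts)
satisfy `Σ m(ρ) f_n(Im ρ) ≥ liWindowBound n T₂ = (T₂/4π)(log(T₂/2π) − 0.31) − 0.36(T₂²/n)log(T₂/2π)
− 1.24 log T₂ − 14 − (2.30 + 0.128 log(T₂/2π))(4n/T₂² + (7/3)n²/T₂³)` — Riemann–von Mangoldt main
term, stationary-phase-free oscillatory bound, Backlund boundary terms, Turing's ∫S bound by parts.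
[difficulty: L] -/
@[route_item "route-RiemannHypothesis-LiCoefficients", crux]
def LiWindowLowerBound : Prop :=
  ∀ (n : ℕ) (T₂ : ℝ), 1 ≤ n → 1100 ≤ T₂ → Summit.RiemannHypothesis.RiemannHypothesis.Theorems.LiTheory.liWindowBound n T₂ ≤ ∑ ρ ∈ Literature.NumberTheory.LFunctions.SchoenfeldBound.zerosBetween (T₂ / 2) T₂, (Literature.NumberTheory.LFunctions.riemannZetaZeroOrder ρ : ℝ) * Summit.RiemannHypothesis.RiemannHypothesis.Theorems.LiTheory.liWindowWeight n ρ.im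

/-- `LiWindowLowerBound` holds: proved by `Summit.RiemannHypothesis.RiemannHypothesis.Theorems.LiTheory.liWindowLowerBound_bound` @ ce3e7fc06eb8. -/
theorem LiWindowLowerBound_holds : LiWindowLowerBound := _root_.Summit.RiemannHypothesis.RiemannHypothesis.Theorems.LiTheory.liWindowLowerBound_bound

/-- item stmt-RiemannHypothesis-19470 · crux · rank 4 · closed · proved by Summit.RiemannHypothesis.RiemannHypothesis.Theorems.LiTheory.liHeightBudget_proof @ 7c59fe010a3b (prover) · by planner
why it might fail: only a float grid was run (min 0.42·T at n = 2π(T−4), T = 10⁵); an interval-arithmetic pass could find a dip between grid points near the seam n ≈ 13T where the regime switches — then c = 1/5 drops to the crude 1/10.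
sources: BrownLiCriterion2005, folder:budget_cases.py
[crux] (L6) The closed real inequality: for `T ≥ 10⁵`, `2π(T − 4) < n ≤ T²/5` and `T₂ = min(T,
n/13)`: `0 ≤ 2·liWindowBound n T₂ − 2.82 n² log T/(6πT³)` (two regimes: `n ≥ 13T` concave in ε =
n/T², endpoints 0.76T / 0.95T; `n < 13T` minimum 0.42T at the seam; float grid budget_cases.py).
[deps: LiWindowLowerBound, LiFarZeroTail] [difficulty: M] -/
@[route_item "route-RiemannHypothesis-LiCoefficients", crux]
def LiHeightBudget : Prop :=
  ∀ (n : ℕ) (T : ℝ), (10 : ℝ) ^ 5 ≤ T → 2 * Real.pi * (T - 4) < n → (n : ℝ) ≤ 1 / 5 * T ^ 2 → 0 ≤ 2 * Summit.RiemannHypothesis.RiemannHypothesis.Theorems.LiTheory.liWindowBound n (min T (n / 13)) - 2.82 * (n : ℝ) ^ 2 * (Real.log T / (6 * Real.pi * T ^ 3))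

-- `LiHeightBudget` holds: proved by `Summit.RiemannHypothesis.RiemannHypothesis.Theorems.LiTheory.liHeightBudget_proof` @ 7c59fe010a3b (its module imports this route file, so no `_holds` link can be stated here).

/-- item stmt-RiemannHypothesis-19469 · support · rank 9 · closed · proved by Summit.RiemannHypothesis.RiemannHypothesis.Theorems.LiTheory.liFarZeroTail_proof @ 7c59fe010a3b (prover) · by planner
why it might fail: it cannot any more — proved in the tree (before: the constant is tight to 5%·log at T = 1000).
sources: Trudgian2014, RosserSchoenfeld1975, doi:10.1090/S0025-5718-1975-0369287-6, tree:Theorems/LiCoefficientsLiFarZeroTail.lean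
[support] (L3; PROVED IN TREE 2026-08-25T20:40Z as
`Summit.RiemannHypothesis.RiemannHypothesis.Theorems.LiTheory.liFarZeroTail_bound`,
Theorems/LiCoefficientsLiFarZeroTail.lean, p407363 commit e3ee6eed1ac0 — verbatim this signature;
kept as an in-cone SUPPORT item cited by name so `closes`/Assembly keep their shape, closes at birth
by type match) RH-free zero counting: for `1000 ≤ T ≤ U`, `Σ_{T<Im ρ≤U} m(ρ)/(Im ρ)⁴ ≤ log T/(6πT³)`
(partial summation of t⁻⁴ against the explicit two-height count `N(t) − N(T)`; main term `(log(T/2π)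
+ 1/3)/(6πT³)`, slack `(log 2π − 1/3)/(6πT³)` covers the S-terms `(1.24 log T + 6.8)/T⁴`).
[difficulty: provable-now] -/
@[route_item "route-RiemannHypothesis-LiCoefficients", crux]
def LiFarZeroTail : Prop :=
  ∀ (T U : ℝ), 1000 ≤ T → T ≤ U → ∑ ρ ∈ Literature.NumberTheory.LFunctions.SchoenfeldBound.zerosBetween T U, (Literature.NumberTheory.LFunctions.riemannZetaZeroOrder ρ : ℝ) / ρ.im ^ 4 ≤ Real.log T / (6 * Real.pi * T ^ 3)

-- `LiFarZeroTail` holds: proved by `Summit.RiemannHypothesis.RiemannHypothesis.Theorems.LiTheory.liFarZeroTail_proof` @ 7c59fe010a3b (its module imports this route file, so no `_holds` link can be stated here).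

/-- item stmt-RiemannHypothesis-19471 · assembly · rank 1 · closed · proved by Summit.RiemannHypothesis.RiemannHypothesis.Theorems.LiTheory.assembly_proof @ 7c59fe010a3b (prover) · by planner
sources: BrownLiCriterion2005, Li1997
[assembly] LiBoxSplit → LiWindowLowerBound → LiFarZeroTail → LiHeightBudget → the rung leaf
LiHeightLawQuadratic (provable now; proof supplied in HOME/theory/route/AssemblyProof.lean). -/
@[route_item "route-RiemannHypothesis-LiCoefficients", crux]
def Assembly : Prop :=
  LiBoxSplit → LiWindowLowerBound → LiFarZeroTail → LiHeightBudget → Summit.RiemannHypothesis.RiemannHypothesis.Theorems.LiTheory.LiHeightLawQuadratic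

-- `Assembly` holds: proved by `Summit.RiemannHypothesis.RiemannHypothesis.Theorems.LiTheory.assembly_proof` @ 7c59fe010a3b (its module imports this route file, so no `_holds` link can be stated here).

/-! D-0027 §2.1 — DECIDING THEOREM (planner-authored via `route open/edit --closes-file`; by planner-rh-li-theory-g4-0 2026-08-25T21:47:56Z) — ARCHIVED: route closed (proved) 2026-08-26T11:49:22Z; kept so importers keep building:
its hypotheses are this route's items and its conclusion the registered leaf `Summit.RiemannHypothesis.RiemannHypothesis.Theorems.LiTheory.LiHeightLawQuadratic` (rung L-P(P1), D-0061) (glue_lint), and it elaborates with this file. -/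

-- glue.lean — DECIDING THEOREM of route LiCoefficients (D-0027 §2.1; R5 shape, D-0061: concludes the RUNG LEAF
-- `Summit.RiemannHypothesis.RiemannHypothesis.Theorems.LiTheory.LiHeightLawQuadratic` BY NAME).
-- Hypotheses = the three crux decls + the support LiFarZeroTail (PROVED in tree: `LiTheory.liFarZeroTail_bound`) + the
-- provable-now Assembly item; every binder is consumed (BC1: 5 binders, 3 open cruxes; BC6 clean).
@[closes "route-RiemannHypothesis-LiCoefficients"] theorem closes (h5 : LiBoxSplit) (h4 : LiWindowLowerBound) (h3 : LiFarZeroTail) (h6 : LiHeightBudget)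
    (hA : Assembly) :
    Summit.RiemannHypothesis.RiemannHypothesis.Theorems.LiTheory.LiHeightLawQuadratic :=
  hA h5 h4 h3 h6

end Summit.RiemannHypothesis.RiemannHypothesis.Theses.LiCoefficients
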